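import Mathlib
import Literature.MathematicalPhysics.StatisticalMechanics.LennardJonesClusters
import Literature.MathematicalPhysics.StatisticalMechanics.BarlowStackingEnergy
import Summits.AtomisticToContinuum.Crystallization.Theorems.SquareWellLayerCakeStackingFaultSparsityDefs
import Summits.AtomisticToContinuum.Crystallization.Theorems.PricedLinkCensusStackingHingeFarTail
import Summits.AtomisticToContinuum.Crystallization.Theorems.PricedLinkCensusStackingHingeSiteEnergyNearMatched
import Summits.AtomisticToContinuum.Crystallization.Theorems.PricedLinkCensusStackingHingeHcpMatchedSiteEnergy
import Summits.AtomisticToContinuum.Crystallization.Theorems.SquareWellLayerCakeStackingFaultSparsityFarPasteLattice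

/-!
# Far-paste surgery for `StackingFaultSparsity` (line `Sketch`), II:
# matched site energies and the particle count

Helper file of stub `stub_farPaste` of the crux `StackingFaultSparsity` (item
stmt-AtomisticToContinuum-14296, routes `SquareWellLayerCake` / `LaminarSixThreeThree`).

* §3, site energies of matched windows: if the window of particle `p` of a `δ₀`-separated
  configuration `y` is two-way `(ℓ, θ)`-matched (`TwoWay`) to a `δ₀`-separated point set `S` based
  at `P ∈ S` after a linear isometry `A`, then `|𝓔ᵖ_LJ(y) - ∑_{z ∈ S, z ≠ P} V_LJ(|P - z|)| ≤
  C(δ₀) (θ + ℓ⁻³)` (`abs_siteEnergy_sub_latticeSum_le`: the finite piece `S ∩ B(P, 2ℓ)` is a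
  separated configuration two-way matched to `y` under the rigid motion `v ↦ P + A⁻¹(v - y p)`, so
  `PricedHcpWindowsSiteEnergyContinuity.stub_siteEnergyNearMatched` applies; the rest of `S` is a
  far tail, `PricedHcpWindowsMatchedEnergy.tsum_far_le`).  With part I this gives the WORD-UNIFORM
  lower bound `𝓔ᵖ_LJ(y) ≥ 2 (e₀(a,h) - ∑_{k ≥ 2} |J_k(a,h)|) - C (θ + ℓ⁻³)` for windows matched to
  any Barlow stacking with `a, h > 1/2` (`siteEnergy_matched_ge`, `δ₀ ≤ 1/2`).
* §4, the particle count: a window two-way `(L, ε)`-matched (`ε ≤ 1/8`) to a Barlow stacking with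
  `a, h ∈ (1/2, 2)` contains at least `(r/8)³` particles within `r` of its centre, `8 ≤ r ≤ L`
  (`count_lower_of_twoWay`: index box about the base point, first matching clause, injectivity by
  `le_dist_barlowPos`; the pattern of `lower_count` in the covering file).
-/

noncomputable section
namespace Summit.AtomisticToContinuum.Crystallization.Theorems.SquareWellLayerCake.StackingFaultSparsity
open Literature.MathematicalPhysics.StatisticalMechanics

/-! ## 3. Matched site energies -/

/-- **Site energy vs. punctured lattice sum for a two-way matched window.**  For `0 < δ₀ ≤ 1`
there is `C ≥ 0` such that for `ℓ ≥ 2`, `0 < θ ≤ δ₀/4`, a `δ₀`-separated configuration `y`, a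
`δ₀`-separated point set `S ∋ P` and a window of `p` two-way `(ℓ, θ)`-matched to `S` based at `P`,
`|𝓔ᵖ_LJ(y) - ∑_{z ∈ S, z ≠ P} V_LJ(|P - z|)| ≤ C (θ + ℓ⁻³)` (comparison with the finite piece
`S ∩ B(P, 2ℓ)` enumerated as a configuration, `stub_siteEnergyNearMatched` for the rigid motion
`v ↦ P + A⁻¹ (v - y p)`; far tail of the rest, `tsum_far_le`). -/
theorem abs_siteEnergy_sub_latticeSum_le :
    ∀ δ₀ : ℝ, 0 < δ₀ → δ₀ ≤ 1 → ∃ C : ℝ, 0 ≤ C ∧ ∀ (ℓ θ : ℝ), 2 ≤ ℓ → 0 < θ → θ ≤ δ₀ / 4 →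
      ∀ (N : ℕ) (y : Fin N → EuclideanSpace ℝ (Fin 3)),
      (∀ i j : Fin N, i ≠ j → δ₀ ≤ dist (y i) (y j)) →
      ∀ (p : Fin N) (S : Set (EuclideanSpace ℝ (Fin 3))) (P : EuclideanSpace ℝ (Fin 3))
      (A : EuclideanSpace ℝ (Fin 3) →ₗᵢ[ℝ] EuclideanSpace ℝ (Fin 3)),
      (∀ z ∈ S, ∀ z' ∈ S, z ≠ z' → δ₀ ≤ dist z z') → P ∈ S → TwoWay S ℓ θ y p P A →
      |siteEnergy lennardJones y p - ∑' z : {z // z ∈ S ∧ z ≠ P}, lennardJones (dist P z.1)| ≤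
        C * (θ + ℓ⁻¹ ^ 3) := by
  intro δ₀ hδ₀ hδ₁
  obtain ⟨CT, hCT0, hCT⟩ := PricedHcpWindowsFarTail.stub_farTail δ₀ hδ₀
  obtain ⟨CM, hCM0, hCM⟩ :=
    PricedHcpWindowsSiteEnergyContinuity.stub_siteEnergyNearMatched δ₀ hδ₀ hδ₁
  refine ⟨CM + CT, by positivity, ?_⟩
  intro ℓ θ hℓ hθ hθδ N y hsep p S P A hS hP hW
  classical
  have hℓ0 : 0 < ℓ := by linarith
  -- the finite piece `T = S ∩ B(P, 2ℓ)`, enumerated as a separated configuration `y'`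
  obtain ⟨T, hT⟩ : ∃ T : Finset (EuclideanSpace ℝ (Fin 3)),
      ↑T = S ∩ Metric.closedBall P (2 * ℓ) :=
    ⟨(finite_inter_closedBall_of_separated hδ₀ hS P (2 * ℓ)).toFinset, by simp⟩
  have hTmem : ∀ z, z ∈ T ↔ z ∈ S ∧ dist z P ≤ 2 * ℓ := fun z => by
    rw [← Finset.mem_coe, hT]
    simp [Metric.mem_closedBall]
  have hPT : P ∈ T := (hTmem P).2 ⟨hP, by rw [dist_self]; positivity⟩
  have hTsep : ∀ c ∈ T, ∀ d ∈ T, c ≠ d → δ₀ ≤ dist c d := fun c hc d hd hcd =>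
    hS c ((hTmem c).1 hc).1 d ((hTmem d).1 hd).1 hcd
  obtain ⟨N', y', i', hyi, hymem, hysurj, hsep', hsum⟩ := exists_fin_enum_onto T hPT hTsep
  -- the rigid motion `g = F⁻¹`, `F q = y p + A (q - P)`
  set F : EuclideanSpace ℝ (Fin 3) ≃ᵃⁱ[ℝ] EuclideanSpace ℝ (Fin 3) :=
    AffineIsometryEquiv.mk' (fun q => y p + A (q - P))
    (A.toLinearIsometryEquiv rfl) P (fun q => by
      simp only [vsub_eq_sub, vadd_eq_add, LinearIsometry.coe_toLinearIsometryEquiv, sub_self,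
        map_zero, add_zero]
      exact add_comm _ _) with hFdef
  have hF : ∀ q, F q = y p + A (q - P) := fun q => rfl
  have hFP : F P = y p := by rw [hF, sub_self, map_zero, add_zero]
  set g : EuclideanSpace ℝ (Fin 3) ≃ᵃⁱ[ℝ] EuclideanSpace ℝ (Fin 3) := F.symm with hg
  have hgp : g (y p) = P := by rw [hg, ← hFP, F.symm_apply_apply]
  have hgd : ∀ q v, dist q (g v) = dist (y p + A (q - P)) v := fun q v => by
    rw [← F.dist_map q (g v), hg, F.apply_symm_apply, hF]
  have himg : ∀ q, dist q P = dist (y p + A (q - P)) (y p) := fun q => by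
    rw [dist_self_add_left, LinearIsometry.norm_map, dist_eq_norm]
  -- the two matching hypotheses of `stub_siteEnergyNearMatched`
  have h1 : ∀ j : Fin N, dist (y p) (y j) ≤ ℓ → ∃ j' : Fin N', dist (y' j') (g (y j)) ≤ θ := by
    intro j hj
    obtain ⟨q, hqS, hjq⟩ := hW.2 j (by rwa [dist_comm])
    have hqT : q ∈ T := by
      refine (hTmem q).2 ⟨hqS, ?_⟩
      have e2 := dist_triangle (y p + A (q - P)) (y j) (y p)
      rw [dist_comm (y p + A (q - P)) (y j), ← himg, dist_comm (y j) (y p)] at e2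
      linarith
    obtain ⟨j', hj'⟩ := hysurj q hqT
    exact ⟨j', by rw [hgd, hj', dist_comm]; exact hjq⟩
  have h2 : ∀ j' : Fin N', dist (y' i') (y' j') ≤ ℓ → ∃ j : Fin N, dist (y' j') (g (y j)) ≤ θ := by
    intro j' hj'
    obtain ⟨hqS, -⟩ := (hTmem _).1 (hymem j')
    obtain ⟨j, hj⟩ := hW.1 (y' j') hqS (by rw [← hyi, dist_comm]; exact hj')
    exact ⟨j, by rw [hgd, dist_comm]; exact hj⟩
  have hmain := hCM ℓ θ hℓ hθ hθδ N y N' y' hsep hsep' p i' g (hgp.trans hyi.symm) h1 h2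
  -- `𝓔^{i'}(y')` is the sum over `T ∖ {P}`
  have hE' : siteEnergy lennardJones y' i' = ∑ z ∈ T.erase P, lennardJones (dist P z) := by
    unfold siteEnergy
    rw [hyi, hsum]
  -- the lattice sum splits into the sum over `T ∖ {P}` and a far tail
  have hsumV := summable_lennardJones_of_separated hδ₀ hS hP
  have hsum6 := summable_inv_pow_six_of_separated hδ₀ hS hP
  obtain ⟨sT, hsT⟩ : ∃ sT : Finset {z // z ∈ S ∧ z ≠ P},
      sT = (T.erase P).subtype (fun z => z ∈ S ∧ z ≠ P) := ⟨_, rfl⟩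
  have hsT_sum : ∀ Φ : EuclideanSpace ℝ (Fin 3) → ℝ,
      ∑ z ∈ sT, Φ z.1 = ∑ z ∈ T.erase P, Φ z := by
    intro Φ
    rw [hsT, Finset.sum_subtype_of_mem Φ (fun z hz =>
      ⟨((hTmem z).1 (Finset.mem_of_mem_erase hz)).1, Finset.ne_of_mem_erase hz⟩)]
  have hsplit : ∑' z : {z // z ∈ S ∧ z ≠ P}, lennardJones (dist P z.1) =
      ∑ z ∈ T.erase P, lennardJones (dist P z) +
        ∑' z : {z : {z // z ∈ S ∧ z ≠ P} // z ∉ sT}, lennardJones (dist P z.1.1) := by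
    rw [← hsumV.sum_add_tsum_subtype_compl sT, hsT_sum (fun z => lennardJones (dist P z))]
  have hfar : ∀ z : {z // z ∈ S ∧ z ≠ P}, z ∉ sT → 2 * ℓ < dist P z.1 := by
    intro z hz
    by_contra hle
    rw [not_lt] at hle
    apply hz
    rw [hsT, Finset.mem_subtype]
    exact Finset.mem_erase.2 ⟨z.2.2, (hTmem _).2 ⟨z.2.1, by rw [dist_comm]; exact hle⟩⟩
  have htail : |∑' z : {z : {z // z ∈ S ∧ z ≠ P} // z ∉ sT}, lennardJones (dist P z.1.1)| ≤
      CT * ℓ⁻¹ ^ 3 := by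
    have hVs : Summable fun z : {z : {z // z ∈ S ∧ z ≠ P} // z ∉ sT} =>
        lennardJones (dist P z.1.1) := hsumV.subtype _
    have h6s : Summable fun z : {z : {z // z ∈ S ∧ z ≠ P} // z ∉ sT} =>
        (dist P z.1.1)⁻¹ ^ 6 := hsum6.subtype _
    have hle : ∀ z : {z : {z // z ∈ S ∧ z ≠ P} // z ∉ sT},
        |lennardJones (dist P z.1.1)| ≤ (dist P z.1.1)⁻¹ ^ 6 := fun z =>
      PricedHcpWindowsSiteEnergyContinuity.abs_lennardJones_le_of_one_le
        (by linarith [hfar z.1 z.2])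
    have ht := PricedHcpWindowsMatchedEnergy.tsum_far_le hδ₀ hCT0 hCT hS hP
      (show δ₀ ≤ 2 * ℓ by linarith) (p := fun z => z ∉ sT) (fun z hz => (hfar z hz).le)
    have h2ℓ : CT * (2 * ℓ)⁻¹ ^ 3 ≤ CT * ℓ⁻¹ ^ 3 :=
      mul_le_mul_of_nonneg_left
        (pow_le_pow_left₀ (by positivity) (inv_anti₀ hℓ0 (by linarith)) 3) hCT0
    have hup := hVs.tsum_le_tsum (fun z => (abs_le.1 (hle z)).2) h6s
    have hlow := h6s.neg.tsum_le_tsum (fun z => (abs_le.1 (hle z)).1) hVs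
    rw [tsum_neg] at hlow
    rw [abs_le]
    constructor <;> linarith
  -- assembly
  rw [hsplit, ← hE']
  have e : siteEnergy lennardJones y p - (siteEnergy lennardJones y' i' +
      ∑' z : {z : {z // z ∈ S ∧ z ≠ P} // z ∉ sT}, lennardJones (dist P z.1.1)) =
      (siteEnergy lennardJones y p - siteEnergy lennardJones y' i') -
        ∑' z : {z : {z // z ∈ S ∧ z ≠ P} // z ∉ sT}, lennardJones (dist P z.1.1) := by ring
  rw [e]
  refine (abs_sub _ _).trans ?_
  have hθT : 0 ≤ CT * θ := by positivity
  have hℓ3 : 0 ≤ ℓ⁻¹ ^ 3 := by positivity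
  nlinarith [hmain, htail]

/-- **Matched site energies are at least `2 (e₀ - ∑ |J_k|) - C (θ + ℓ⁻³)`** (uniformly in
`a, h > 1/2` and in the Hägg word). -/
theorem siteEnergy_matched_ge :
    ∀ δ₀ : ℝ, 0 < δ₀ → δ₀ ≤ 1 / 2 → ∃ C : ℝ, 0 ≤ C ∧ ∀ (ℓ θ : ℝ), 2 ≤ ℓ → 0 < θ → θ ≤ δ₀ / 4 →
      ∀ (N : ℕ) (y : Fin N → EuclideanSpace ℝ (Fin 3)),
      (∀ i j : Fin N, i ≠ j → δ₀ ≤ dist (y i) (y j)) →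
      ∀ (p : Fin N) (a h : ℝ) (s : ℤ → ℤ) (k i j : ℤ)
      (A : EuclideanSpace ℝ (Fin 3) →ₗᵢ[ℝ] EuclideanSpace ℝ (Fin 3)), 1 / 2 < a →
      1 / 2 < h → IsHaggSeq s → TwoWay (barlowStacking a h s) ℓ θ y p (barlowPos a h s k i j) A →
      2 * (barlowBaseEnergy lennardJones a h -
          ∑' n : ℕ, |barlowCoupling lennardJones a h (n + 2)|) - C * (θ + ℓ⁻¹ ^ 3) ≤
        siteEnergy lennardJones y p := by
  intro δ₀ hδ₀ hδh
  obtain ⟨C, hC0, hC⟩ := abs_siteEnergy_sub_latticeSum_le δ₀ hδ₀ (by linarith)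
  refine ⟨C, hC0, ?_⟩
  intro ℓ θ hℓ hθ hθδ N y hsep p a h s k i j A ha hh hs hW
  have ha0 : 0 < a := by linarith
  have hh0 : 0 < h := by linarith
  have hSsep : ∀ z ∈ barlowStacking a h s, ∀ z' ∈ barlowStacking a h s, z ≠ z' →
      δ₀ ≤ dist z z' := fun z hz z' hz' hne =>
    le_trans (by rw [le_min_iff]; constructor <;> linarith)
      (le_dist_of_mem_barlowStacking a h s ha0.le hh0.le hz hz' hne)
  have h1 := hC ℓ θ hℓ hθ hθδ N y hsep p _ _ A hSsep (barlowPos_mem _ _ _) hW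
  have h2 := latticeSiteSum_ge ha0 hh0 hs k i j
  rw [abs_le] at h1
  linarith [h1.2]

/-! ## 4. Counting particles in the half window -/

/-- A window sum of length `n` of a `±1` sequence has absolute value `≤ n`. -/
private theorem abs_haggWindow_le' {s : ℤ → ℤ} (hs : IsHaggSeq s) (m : ℤ) (n : ℕ) :
    |haggWindow s m n| ≤ n := by
  -- adapted from `SquareWellLayerCakeStackingFaultSparsityCovering.lean`
  induction n with
  | zero => simp
  | succ n ih =>
    rw [haggWindow_succ]
    have h1 : |s (m + n)| ≤ 1 := by rcases hs (m + n) with h | h <;> simp [h]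
    calc |haggWindow s m n + s (m + n)| ≤ |haggWindow s m n| + |s (m + n)| := abs_add_le _ _
      _ ≤ (n : ℤ) + 1 := by linarith
      _ = ((n + 1 : ℕ) : ℤ) := by push_cast; ring

/-- The layer labels of a Hägg word change by at most `|k' - k|` between layers `k` and `k'`. -/
private theorem abs_haggLabel_sub_le' {s : ℤ → ℤ} (hs : IsHaggSeq s) (k k' : ℤ) :
    |haggLabel s k' - haggLabel s k| ≤ |k' - k| := by
  rcases le_total k k' with hle | hle
  · obtain ⟨n, rfl⟩ : ∃ n : ℕ, k' = k + n := ⟨(k' - k).toNat, by omega⟩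
    rw [haggLabel_add_natCast, add_sub_cancel_left, add_sub_cancel_left, Nat.abs_cast]
    exact abs_haggWindow_le' hs k n
  · obtain ⟨n, rfl⟩ : ∃ n : ℕ, k = k' + n := ⟨(k - k').toNat, by omega⟩
    rw [haggLabel_add_natCast, abs_sub_comm, add_sub_cancel_left, abs_sub_comm, add_sub_cancel_left,
      Nat.abs_cast]
    exact abs_haggWindow_le' hs k' n

/-- Stacking points whose three indices differ by at most `D` are within `6 D` of each other
(for `0 ≤ a ≤ 2`, `0 ≤ h ≤ 2`). -/
private theorem dist_barlowPos_le_of_abs_le' {a h D : ℝ} {s : ℤ → ℤ} (ha0 : 0 ≤ a) (ha1 : a ≤ 2)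
    (hh0 : 0 ≤ h) (hh1 : h ≤ 2) (hs : IsHaggSeq s) {k i j k' i' j' : ℤ}
    (hk : |(k' : ℝ) - k| ≤ D) (hi : |(i' : ℝ) - i| ≤ D) (hj : |(j' : ℝ) - j| ≤ D) :
    dist (barlowPos a h s k' i' j') (barlowPos a h s k i j) ≤ 6 * D := by
  have hD : 0 ≤ D := (abs_nonneg _).trans hk
  have hL : |(haggLabel s k' : ℝ) - haggLabel s k| ≤ D :=
    le_trans (by exact_mod_cast abs_haggLabel_sub_le' hs k k') hk
  have h3 : (√3 : ℝ) ^ 2 = 3 := Real.sq_sqrt (by norm_num)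
  obtain ⟨hk1, hk2⟩ := abs_le.mp hk
  obtain ⟨hi1, hi2⟩ := abs_le.mp hi
  obtain ⟨hj1, hj2⟩ := abs_le.mp hj
  obtain ⟨hL1, hL2⟩ := abs_le.mp hL
  have ha2 : a ^ 2 ≤ 4 := by nlinarith
  have hh2 : h ^ 2 ≤ 4 := by nlinarith
  refine (pow_le_pow_iff_left₀ dist_nonneg (by positivity) two_ne_zero).1 ?_
  rw [dist_barlowPos_sq]
  set X := (i' : ℝ) - i + ((j' : ℝ) - j) / 2 + ((haggLabel s k' : ℝ) - haggLabel s k) / 2 with hXd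
  set Y := (j' : ℝ) - j + ((haggLabel s k' : ℝ) - haggLabel s k) / 3 with hYd
  have hX : X ^ 2 ≤ (2 * D) ^ 2 := sq_le_sq' (by rw [hXd]; linarith) (by rw [hXd]; linarith)
  have hY : Y ^ 2 ≤ (4 * D / 3) ^ 2 := sq_le_sq' (by rw [hYd]; linarith) (by rw [hYd]; linarith)
  have hT : ((k' : ℝ) - k) ^ 2 ≤ D ^ 2 := sq_le_sq' (by linarith) (by linarith)
  calc (a * X) ^ 2 + (a * √3 / 2 * Y) ^ 2 + (((k' : ℝ) - k) * h) ^ 2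
      = a ^ 2 * X ^ 2 + a ^ 2 * (3 / 4) * Y ^ 2 + h ^ 2 * ((k' : ℝ) - k) ^ 2 := by
        rw [mul_pow, mul_pow, mul_pow, div_pow, mul_pow, h3]; ring
    _ ≤ 4 * (2 * D) ^ 2 + 4 * (3 / 4) * (4 * D / 3) ^ 2 + 4 * D ^ 2 := by gcongr
    _ ≤ (6 * D) ^ 2 := by nlinarith

/-- **Lower count**: if the window of `i` is two-way `(L, ε)`-matched to a Barlow stacking with
`a, h ∈ (1/2, 2)`, `ε ≤ 1/8`, then for `8 ≤ r ≤ L` at least `(r/8)³` particles lie within `r` of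
`y i` (index box of half-width `⌊r/8⌋` about the base, first matching clause,
`le_dist_barlowPos`). -/
theorem count_lower_of_twoWay {N : ℕ} (y : Fin N → EuclideanSpace ℝ (Fin 3)) (i : Fin N)
    {a h L ε r : ℝ} {s : ℤ → ℤ} {z : EuclideanSpace ℝ (Fin 3)}
    {A : EuclideanSpace ℝ (Fin 3) →ₗᵢ[ℝ] EuclideanSpace ℝ (Fin 3)} (ha1 : 1 / 2 < a) (ha2 : a < 2)
    (hh1 : 1 / 2 < h) (hh2 : h < 2)
    (hs : IsHaggSeq s) (hz : z ∈ barlowStacking a h s)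
    (hW : TwoWay (barlowStacking a h s) L ε y i z A) (hε : ε ≤ 1 / 8) (hr : 8 ≤ r)
    (hrL : r ≤ L) :
    (r / 8) ^ 3 ≤ ((Finset.univ.filter fun j => dist (y j) (y i) ≤ r).card : ℝ) := by
  -- adapted from `lower_count` of `SquareWellLayerCakeStackingFaultSparsityCovering.lean`
  classical
  have ha0 : 0 < a := by linarith
  have hh0 : 0 < h := by linarith
  obtain ⟨k, i₀, j₀, rfl⟩ := hz
  set z := barlowPos a h s k i₀ j₀ with hzdef
  obtain ⟨n, hn⟩ : ∃ n : ℕ, n = ⌊r / 8⌋₊ := ⟨_, rfl⟩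
  have hnr : (n : ℝ) ≤ r / 8 := hn ▸ Nat.floor_le (by positivity)
  have hrn : r / 8 < n + 1 := hn ▸ Nat.lt_floor_add_one _
  obtain ⟨I, hI⟩ : ∃ I : Finset ℤ, I = Finset.Icc (-(n : ℤ)) n := ⟨_, rfl⟩
  have hIcard : I.card = 2 * n + 1 := by rw [hI, Int.card_Icc]; omega
  have hmemI : ∀ m ∈ I, |(m : ℝ)| ≤ n := fun m hm => by
    rw [hI, Finset.mem_Icc] at hm
    exact_mod_cast (abs_le.mpr ⟨hm.1, hm.2⟩ : |m| ≤ (n : ℤ))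
  set P : ℤ × ℤ × ℤ → EuclideanSpace ℝ (Fin 3) := fun t =>
    barlowPos a h s (k + t.1) (i₀ + t.2.1) (j₀ + t.2.2) with hP
  have hPdist : ∀ t ∈ I ×ˢ I ×ˢ I, dist (P t) z ≤ 6 * n := fun t ht => by
    simp only [Finset.mem_product] at ht
    refine dist_barlowPos_le_of_abs_le' ha0.le ha2.le hh0.le hh2.le hs ?_ ?_ ?_ <;>
      push_cast <;> simp only [add_sub_cancel_left]
    exacts [hmemI _ ht.1, hmemI _ ht.2.1, hmemI _ ht.2.2]
  have hPz : ∀ t ∈ I ×ˢ I ×ˢ I, ∃ j : Fin N, dist (y j) (y i + A (P t - z)) ≤ ε := fun t ht =>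
    hW.1 (P t) (barlowPos_mem _ _ _) ((hPdist t ht).trans (by linarith))
  set f : ℤ × ℤ × ℤ → Fin N := fun t =>
    if ht : ∃ j : Fin N, dist (y j) (y i + A (P t - z)) ≤ ε then ht.choose else i with hf
  have hfP : ∀ t ∈ I ×ˢ I ×ˢ I, dist (y (f t)) (y i + A (P t - z)) ≤ ε := fun t ht => by
    simp only [hf, dif_pos (hPz t ht)]
    exact (hPz t ht).choose_spec
  have hmaps : Set.MapsTo f (I ×ˢ I ×ˢ I : Finset (ℤ × ℤ × ℤ))
      (Finset.univ.filter fun j => dist (y j) (y i) ≤ r : Finset (Fin N)) := fun t ht => by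
    have ht : t ∈ I ×ˢ I ×ˢ I := by exact_mod_cast ht
    refine Finset.mem_coe.2 (Finset.mem_filter.2 ⟨Finset.mem_univ _, ?_⟩)
    have := dist_triangle (y (f t)) (y i + A (P t - z)) (y i)
    rw [dist_self_add_left, LinearIsometry.norm_map, ← dist_eq_norm] at this
    linarith [hfP t ht, hPdist t ht]
  have hinj : Set.InjOn f (I ×ˢ I ×ˢ I : Finset (ℤ × ℤ × ℤ)) := fun t ht t' ht' heq => by
    have ht : t ∈ I ×ˢ I ×ˢ I := by exact_mod_cast ht
    have ht' : t' ∈ I ×ˢ I ×ˢ I := by exact_mod_cast ht'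
    have h1 := hfP t ht
    rw [heq] at h1
    have hd : dist (P t) (P t') < min a h := by
      have := dist_triangle_left (y i + A (P t - z)) (y i + A (P t' - z)) (y (f t'))
      rw [dist_add_left, LinearIsometry.dist_map, dist_sub_right] at this
      have hmin : 2 * ε < min a h := lt_min (by linarith) (by linarith)
      linarith [hfP t' ht']
    have : (k + t.1, i₀ + t.2.1, j₀ + t.2.2) = (k + t'.1, i₀ + t'.2.1, j₀ + t'.2.2) := by
      by_contra hne
      exact absurd hd (not_lt.mpr (le_dist_barlowPos a h s ha0.le hh0.le hne))
    simp only [Prod.mk.injEq, add_right_inj] at this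
    exact Prod.ext this.1 (Prod.ext this.2.1 this.2.2)
  have hcard := Finset.card_le_card_of_injOn f hmaps hinj
  rw [Finset.card_product, Finset.card_product, hIcard] at hcard
  calc (r / 8) ^ 3 ≤ ((2 * n + 1 : ℕ) : ℝ) ^ 3 := by gcongr; push_cast; linarith
    _ = (((2 * n + 1) * ((2 * n + 1) * (2 * n + 1)) : ℕ) : ℝ) := by push_cast; ring
    _ ≤ _ := by exact_mod_cast hcard

end Summit.AtomisticToContinuum.Crystallization.Theorems.SquareWellLayerCake.StackingFaultSparsity

end
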